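import Summits.RiemannHypothesis.RiemannHypothesis.Theorems.WeilGroundStateMarkovPartPositiveGroundStatePairs

/-!
# Markov part of Weil's form: convexity of `ρ ↦ 𝓔(√ρ)` and uniqueness of the positive minimiser

Support file for item `MarkovPartPositiveGroundState` of route `WeilGroundState`. For a pure-jump
Dirichlet form `𝓔(u) = ∫∫ j |u(x) − u(y)|²` the map `ρ ↦ 𝓔(√ρ)` is convex on non-negative
densities, because `(√a − √b)² = a + b − 2√(ab)` and the geometric mean is concave; the deficit in
the convexity inequality at the pair `(x, y)` for `M = √(w₀Φ₀² + w₁Φ₁²)` is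

  `F(x, y) = 2(M(x)M(y) − w₀Φ₀(x)Φ₀(y) − w₁Φ₁(x)Φ₁(y)) ≥ 0`,  with
  `(M(x)M(y))² − (w₀Φ₀(x)Φ₀(y) + w₁Φ₁(x)Φ₁(y))² = w₀w₁ (Φ₀(x)Φ₁(y) − Φ₁(x)Φ₀(y))²`

(`geomMean_sq_identity`, `geomMean_deficit_nonneg`, `geomMean_cross_eq_zero`). Consequently
(`nonneg_minimizer_ae_eq`): if `Φ₀, Φ₁ ≥ 0` are two normalised minimisers of `𝓔_a` on the form
domain of the window (energy `≤ E`, where `E‖v‖² ≤ 𝓔_a(v)` on the domain), then the deficit of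
`M = √(Φ₀² + Φ₁²)` must vanish for a.e. pair — the archimedean jump density charges every length —
so `Φ₀(x)Φ₁(y) = Φ₁(x)Φ₀(y)` a.e., i.e. `Φ₀ = Φ₁` a.e. This is the uniqueness half of the
Perron–Frobenius theorem for the ground state (Reed–Simon XIII.44), obtained variationally; as a
corollary the non-negative minimiser is EVEN (`nonneg_minimizer_even`), the form being reflection
invariant (`weilDirichletEnergy_comp_neg`). A first-order version of the same deficit
(`geomMean_deficit_lower`) drives the strict positivity of the minimiser in the sequel.

## References

* M. Reed, B. Simon, *Methods of Modern Mathematical Physics IV* (1978), Thm XIII.44.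
* E. H. Lieb, M. Loss, *Analysis*, 2nd ed. (2001), Thm 7.8 (convexity of the kinetic energy in the
  density) — the local analogue of the argument used here.
-/

-- `Summit.RiemannHypothesis.RiemannHypothesis.…` repeats the summit name by design (D-0017 layout).
set_option linter.dupNamespace false

noncomputable section

open MeasureTheory Set Filter
open scoped Topology ENNReal NNReal

namespace Summit.RiemannHypothesis.RiemannHypothesis.Theorems.WeilGroundStateMarkovPart

open Literature.NumberTheory.LFunctions

/-! ## Pointwise: the geometric-mean deficit -/

/-- The convexity identity behind `ρ ↦ 𝓔(√ρ)`: with `m(p) = √(w₀p₀² + w₁p₁²)`,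
`(m(q) − m(p))² + 2(m(p)m(q) − (w₀p₀q₀ + w₁p₁q₁)) = w₀(q₀ − p₀)² + w₁(q₁ − p₁)²`. -/
theorem geomMean_sq_identity {w₀ w₁ p₀ p₁ q₀ q₁ : ℝ} (hw₀ : 0 ≤ w₀) (hw₁ : 0 ≤ w₁) :
    (Real.sqrt (w₀ * q₀ ^ 2 + w₁ * q₁ ^ 2) - Real.sqrt (w₀ * p₀ ^ 2 + w₁ * p₁ ^ 2)) ^ 2 +
        2 * (Real.sqrt (w₀ * p₀ ^ 2 + w₁ * p₁ ^ 2) * Real.sqrt (w₀ * q₀ ^ 2 + w₁ * q₁ ^ 2) -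
          (w₀ * p₀ * q₀ + w₁ * p₁ * q₁)) =
      w₀ * (q₀ - p₀) ^ 2 + w₁ * (q₁ - p₁) ^ 2 := by
  have hA : Real.sqrt (w₀ * p₀ ^ 2 + w₁ * p₁ ^ 2) ^ 2 = w₀ * p₀ ^ 2 + w₁ * p₁ ^ 2 :=
    Real.sq_sqrt (by positivity)
  have hB : Real.sqrt (w₀ * q₀ ^ 2 + w₁ * q₁ ^ 2) ^ 2 = w₀ * q₀ ^ 2 + w₁ * q₁ ^ 2 :=
    Real.sq_sqrt (by positivity)
  linear_combination hA + hB

/-- The key algebraic identity: `m(p)²m(q)² − (w₀p₀q₀ + w₁p₁q₁)² = w₀w₁(p₀q₁ − p₁q₀)²`. -/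
theorem geomMean_sq_sub_sq {w₀ w₁ p₀ p₁ q₀ q₁ : ℝ} :
    (w₀ * p₀ ^ 2 + w₁ * p₁ ^ 2) * (w₀ * q₀ ^ 2 + w₁ * q₁ ^ 2) - (w₀ * p₀ * q₀ + w₁ * p₁ * q₁) ^ 2 =
      w₀ * w₁ * (p₀ * q₁ - p₁ * q₀) ^ 2 := by
  ring

/-- The deficit is non-negative: `w₀p₀q₀ + w₁p₁q₁ ≤ m(p) m(q)` (Cauchy–Schwarz / concavity of the
geometric mean), for non-negative weights. -/
theorem geomMean_deficit_nonneg {w₀ w₁ p₀ p₁ q₀ q₁ : ℝ} (hw₀ : 0 ≤ w₀) (hw₁ : 0 ≤ w₁) :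
    0 ≤ Real.sqrt (w₀ * p₀ ^ 2 + w₁ * p₁ ^ 2) * Real.sqrt (w₀ * q₀ ^ 2 + w₁ * q₁ ^ 2) -
      (w₀ * p₀ * q₀ + w₁ * p₁ * q₁) := by
  have hA : 0 ≤ w₀ * p₀ ^ 2 + w₁ * p₁ ^ 2 := by positivity
  rw [← Real.sqrt_mul hA, sub_nonneg]
  refine (le_abs_self _).trans (Real.abs_le_sqrt ?_)
  have := geomMean_sq_sub_sq (w₀ := w₀) (w₁ := w₁) (p₀ := p₀) (p₁ := p₁) (q₀ := q₀) (q₁ := q₁)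
  nlinarith [mul_nonneg (mul_nonneg hw₀ hw₁) (sq_nonneg (p₀ * q₁ - p₁ * q₀))]

/-- **Rigidity of the deficit**: if the deficit vanishes then `w₀w₁(p₀q₁ − p₁q₀)² = 0`. -/
theorem geomMean_cross_eq_zero {w₀ w₁ p₀ p₁ q₀ q₁ : ℝ} (hw₀ : 0 ≤ w₀) (hw₁ : 0 ≤ w₁)
    (h : Real.sqrt (w₀ * p₀ ^ 2 + w₁ * p₁ ^ 2) * Real.sqrt (w₀ * q₀ ^ 2 + w₁ * q₁ ^ 2) -
      (w₀ * p₀ * q₀ + w₁ * p₁ * q₁) = 0) :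
    w₀ * w₁ * (p₀ * q₁ - p₁ * q₀) ^ 2 = 0 := by
  have hA : Real.sqrt (w₀ * p₀ ^ 2 + w₁ * p₁ ^ 2) ^ 2 = w₀ * p₀ ^ 2 + w₁ * p₁ ^ 2 :=
    Real.sq_sqrt (by positivity)
  have hB : Real.sqrt (w₀ * q₀ ^ 2 + w₁ * q₁ ^ 2) ^ 2 = w₀ * q₀ ^ 2 + w₁ * q₁ ^ 2 :=
    Real.sq_sqrt (by positivity)
  have h1 : Real.sqrt (w₀ * p₀ ^ 2 + w₁ * p₁ ^ 2) * Real.sqrt (w₀ * q₀ ^ 2 + w₁ * q₁ ^ 2) =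
      w₀ * p₀ * q₀ + w₁ * p₁ * q₁ := by linarith
  have h2 : (w₀ * p₀ ^ 2 + w₁ * p₁ ^ 2) * (w₀ * q₀ ^ 2 + w₁ * q₁ ^ 2) =
      (w₀ * p₀ * q₀ + w₁ * p₁ * q₁) ^ 2 := by
    rw [← hA, ← hB, ← mul_pow, h1]
  rw [← geomMean_sq_sub_sq, h2, sub_self]

/-- **First-order size of the deficit at a zero**: for `w₀ = 1`, `w₁ = r²`, `0 ≤ r ≤ 1/2`,
`p₀ = 0` and `0 ≤ q₁ ≤ q₀`, the deficit is at least `r p₁ q₀ / 2`: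
`r p₁ q₀ ≤ 2(m(p)m(q) − (p₀q₀ + r²p₁q₁))` (it is of order `r = √(r²)`, not `r²`; this is what
makes a zero of a minimiser on the window impossible). -/
theorem geomMean_deficit_lower {r p₀ p₁ q₀ q₁ : ℝ} (hr : 0 ≤ r) (hr' : r ≤ 1 / 2)
    (hp₀ : p₀ = 0) (hp₁ : 0 ≤ p₁) (hq₁ : 0 ≤ q₁) (hle : q₁ ≤ q₀) :
    r * p₁ * q₀ ≤ 2 * (Real.sqrt (1 * p₀ ^ 2 + r ^ 2 * p₁ ^ 2) *
      Real.sqrt (1 * q₀ ^ 2 + r ^ 2 * q₁ ^ 2) - (1 * p₀ * q₀ + r ^ 2 * p₁ * q₁)) := by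
  subst hp₀
  have h1 : Real.sqrt (1 * (0 : ℝ) ^ 2 + r ^ 2 * p₁ ^ 2) = r * p₁ := by
    rw [show 1 * (0 : ℝ) ^ 2 + r ^ 2 * p₁ ^ 2 = (r * p₁) ^ 2 by ring]
    exact Real.sqrt_sq (mul_nonneg hr hp₁)
  have h2 : q₀ ≤ Real.sqrt (1 * q₀ ^ 2 + r ^ 2 * q₁ ^ 2) := by
    refine Real.le_sqrt_of_sq_le ?_
    nlinarith [sq_nonneg (r * q₁)]
  rw [h1]
  have h3 : r * p₁ * q₀ ≤ r * p₁ * Real.sqrt (1 * q₀ ^ 2 + r ^ 2 * q₁ ^ 2) :=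
    mul_le_mul_of_nonneg_left h2 (mul_nonneg hr hp₁)
  have hq₀ : 0 ≤ q₀ := hq₁.trans hle
  nlinarith [mul_nonneg (mul_nonneg hr hp₁) hq₁, mul_nonneg hr hp₁,
    mul_nonneg (mul_nonneg hr hp₁) hq₀]

/-! ## `L²` bookkeeping for real functions and their complex embedding -/

/-- `∫ ‖(Φ x : ℂ)‖² = ∫ Φ²`. -/
theorem integral_norm_sq_ofReal (Φ : ℝ → ℝ) : ∫ x, ‖(Φ x : ℂ)‖ ^ 2 = ∫ x, Φ x ^ 2 := by
  refine integral_congr_ae (Eventually.of_forall fun x ↦ ?_)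
  simp only [Complex.norm_real, Real.norm_eq_abs, sq_abs]

/-- `‖(s : ℂ) − (t : ℂ)‖² = (s − t)²`. -/
theorem norm_ofReal_sub_sq (s t : ℝ) : ‖(s : ℂ) - (t : ℂ)‖ ^ 2 = (s - t) ^ 2 := by
  rw [← Complex.ofReal_sub, Complex.norm_real, Real.norm_eq_abs, sq_abs]

/-! ## Uniqueness of the non-negative minimiser -/

/-- **Uniqueness of the non-negative minimiser (Perron–Frobenius, uniqueness half).** Let `E` be a
lower bound of the Dirichlet energy on the form domain of the window,
`E ∫|v|² ≤ 𝓔_a(v)` for every `v ∈ L²` vanishing off `[-a, a]` with finite archimedean energy, and let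
`Φ₀, Φ₁ ≥ 0` be measurable, square integrable, vanishing off `[-a, a]`, normalised (`∫ Φᵢ² = 1`), of
finite archimedean energy and of energy `≤ E` (two non-negative ground states). Then `Φ₀ = Φ₁`
a.e. Proof: `M = √(Φ₀² + Φ₁²)` lies in the domain with `∫ M² = 2`, so
`𝓔_a(M) + (weighted deficit) = 𝓔_a(Φ₀) + 𝓔_a(Φ₁) ≤ 2E ≤ 𝓔_a(M)` kills the deficit; a.e. pair
rigidity gives `Φ₀(x)Φ₁(y) = Φ₁(x)Φ₀(y)` for a.e. `(x, y)`, and integrating against `Φ₀(y)` gives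
`Φ₁ = cΦ₀` with `c = ∫ Φ₀Φ₁ ≥ 0`, `c² = 1`. -/
theorem nonneg_minimizer_ae_eq {a E : ℝ} {Φ₀ Φ₁ : ℝ → ℝ}
    (hm₀ : Measurable Φ₀) (hm₁ : Measurable Φ₁) (h₀ : ∀ x, 0 ≤ Φ₀ x) (h₁ : ∀ x, 0 ≤ Φ₁ x)
    (hL₀ : MemLp Φ₀ 2) (hL₁ : MemLp Φ₁ 2)
    (hs₀ : ∀ x, x ∉ Icc (-a) a → Φ₀ x = 0) (hs₁ : ∀ x, x ∉ Icc (-a) a → Φ₁ x = 0)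
    (hn₀ : ∫ x, Φ₀ x ^ 2 = 1) (hn₁ : ∫ x, Φ₁ x ^ 2 = 1)
    (hfin₀ : IntegrableOn (fun t ↦ weilArchDensity t * weilIncrement (fun x ↦ (Φ₀ x : ℂ)) t)
      (Ioi 0))
    (hfin₁ : IntegrableOn (fun t ↦ weilArchDensity t * weilIncrement (fun x ↦ (Φ₁ x : ℂ)) t)
      (Ioi 0))
    (hE₀ : weilDirichletEnergy a (fun x ↦ (Φ₀ x : ℂ)) ≤ E)
    (hE₁ : weilDirichletEnergy a (fun x ↦ (Φ₁ x : ℂ)) ≤ E)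
    (hbot : ∀ v : ℝ → ℂ, MemLp v 2 → (∀ x, x ∉ Icc (-a) a → v x = 0) →
      IntegrableOn (fun t ↦ weilArchDensity t * weilIncrement v t) (Ioi 0) →
      E * ∫ x, ‖v x‖ ^ 2 ≤ weilDirichletEnergy a v) :
    Φ₀ =ᵐ[volume] Φ₁ := by
  -- the square-root mean and the deficit
  set M : ℝ → ℝ := fun x ↦ Real.sqrt (1 * Φ₀ x ^ 2 + 1 * Φ₁ x ^ 2) with hMdef
  set F : ℝ → ℝ → ℝ := fun x y ↦
    2 * (M x * M y - (1 * Φ₀ x * Φ₀ y + 1 * Φ₁ x * Φ₁ y)) with hFdef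
  have hF0 : ∀ x y, 0 ≤ F x y := fun x y ↦
    mul_nonneg zero_le_two (geomMean_deficit_nonneg zero_le_one zero_le_one)
  have hFsymm : ∀ x y, F x y = F y x := fun x y ↦ by simp only [hFdef]; ring
  have hMm : Measurable M := by
    simp only [hMdef]
    exact ((measurable_const.mul (hm₀.pow_const 2)).add
      (measurable_const.mul (hm₁.pow_const 2))).sqrt
  have hFm : Measurable (Function.uncurry F) := by
    have e : Function.uncurry F = fun p : ℝ × ℝ ↦
        2 * (M p.1 * M p.2 - (1 * Φ₀ p.1 * Φ₀ p.2 + 1 * Φ₁ p.1 * Φ₁ p.2)) := by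
      funext p; rfl
    rw [e]
    have h1 : Measurable fun p : ℝ × ℝ ↦ M p.1 := hMm.comp measurable_fst
    have h2 : Measurable fun p : ℝ × ℝ ↦ M p.2 := hMm.comp measurable_snd
    have h3 : Measurable fun p : ℝ × ℝ ↦ Φ₀ p.1 := hm₀.comp measurable_fst
    have h4 : Measurable fun p : ℝ × ℝ ↦ Φ₀ p.2 := hm₀.comp measurable_snd
    have h5 : Measurable fun p : ℝ × ℝ ↦ Φ₁ p.1 := hm₁.comp measurable_fst
    have h6 : Measurable fun p : ℝ × ℝ ↦ Φ₁ p.2 := hm₁.comp measurable_snd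
    fun_prop
  -- the pointwise identity
  have hid : ∀ x y, ‖(M y : ℂ) - (M x : ℂ)‖ ^ 2 + F x y =
      1 * ‖(Φ₀ y : ℂ) - (Φ₀ x : ℂ)‖ ^ 2 + 1 * ‖(Φ₁ y : ℂ) - (Φ₁ x : ℂ)‖ ^ 2 := by
    intro x y
    simp only [norm_ofReal_sub_sq, hFdef, hMdef]
    exact geomMean_sq_identity zero_le_one zero_le_one
  -- `L²` data
  have hL₀c : MemLp (fun x ↦ (Φ₀ x : ℂ)) 2 := hL₀.ofReal
  have hL₁c : MemLp (fun x ↦ (Φ₁ x : ℂ)) 2 := hL₁.ofReal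
  have hi₀ : Integrable fun x ↦ Φ₀ x ^ 2 := by
    have := (memLp_two_iff_integrable_sq_norm hL₀.1).1 hL₀
    simpa only [Real.norm_eq_abs, sq_abs] using this
  have hi₁ : Integrable fun x ↦ Φ₁ x ^ 2 := by
    have := (memLp_two_iff_integrable_sq_norm hL₁.1).1 hL₁
    simpa only [Real.norm_eq_abs, sq_abs] using this
  have hMsq : ∀ x, ‖(M x : ℂ)‖ ^ 2 = Φ₀ x ^ 2 + Φ₁ x ^ 2 := fun x ↦ by
    rw [Complex.norm_real, Real.norm_eq_abs, sq_abs, hMdef, Real.sq_sqrt (by positivity)]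
    ring
  have hMc : MemLp (fun x ↦ (M x : ℂ)) 2 := by
    refine (memLp_two_iff_integrable_sq_norm
      (Complex.measurable_ofReal.comp hMm).aestronglyMeasurable).2 ?_
    show Integrable (fun x ↦ ‖(M x : ℂ)‖ ^ 2)
    exact (hi₀.add hi₁).congr (Eventually.of_forall fun x ↦ (hMsq x).symm)
  have hMnorm : ∫ x, ‖(M x : ℂ)‖ ^ 2 = 2 := by
    simp only [hMsq]
    rw [integral_add hi₀ hi₁, hn₀, hn₁]
    norm_num
  have hMs : ∀ x, x ∉ Icc (-a) a → (M x : ℂ) = 0 := fun x hx ↦ by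
    simp only [hMdef, hs₀ x hx, hs₁ x hx]
    norm_num
  -- the energy deficit
  obtain ⟨hfinM, hdef⟩ := lintegral_deficit_le (a := a) hMc hL₀c hL₁c hF0 hid hfin₀ hfin₁
  have hEM : E * 2 ≤ weilDirichletEnergy a (fun x ↦ (M x : ℂ)) := by
    have := hbot _ hMc hMs hfinM
    rwa [hMnorm] at this
  have hzero : ∫⁻ t in Ioi (0 : ℝ), ∫⁻ x, ENNReal.ofReal (weilArchDensity t * F x (x + t)) = 0 := by
    refine le_antisymm (hdef.trans ?_) bot_le
    rw [ENNReal.ofReal_of_nonpos (by linarith)]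
  -- a.e. pair rigidity
  have hae : ∀ᵐ x : ℝ, ∀ᵐ y : ℝ, ENNReal.ofReal (F x y) = 0 :=
    ae_pair_eq_zero_of_ae_lintegral_shift (F := fun x y ↦ ENNReal.ofReal (F x y))
      (ENNReal.measurable_ofReal.comp hFm) (fun x y ↦ by rw [hFsymm])
      (ae_lintegral_shift_eq_zero hFm hF0 hzero)
  have hcross : ∀ᵐ x : ℝ, ∀ᵐ y : ℝ, Φ₀ x * Φ₁ y = Φ₁ x * Φ₀ y := by
    filter_upwards [hae] with x hx
    filter_upwards [hx] with y hy
    have hF00 : F x y = 0 := le_antisymm (ENNReal.ofReal_eq_zero.1 hy) (hF0 x y)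
    have h2 : M x * M y - (1 * Φ₀ x * Φ₀ y + 1 * Φ₁ x * Φ₁ y) = 0 := by
      simp only [hFdef] at hF00
      linarith
    have h3 := geomMean_cross_eq_zero zero_le_one zero_le_one h2
    have h4 : (Φ₀ x * Φ₁ y - Φ₁ x * Φ₀ y) ^ 2 = 0 := by linarith
    exact sub_eq_zero.1 (pow_eq_zero_iff two_ne_zero |>.1 h4)
  -- integrate against `Φ₀(y)`
  set c : ℝ := ∫ y, Φ₀ y * Φ₁ y with hcdef
  have hi01 : Integrable fun y ↦ Φ₀ y * Φ₁ y := hL₀.integrable_mul hL₁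
  have hprop : ∀ᵐ x : ℝ, Φ₁ x = c * Φ₀ x := by
    filter_upwards [hcross] with x hx
    have h1 : ∫ y, Φ₀ y * (Φ₀ x * Φ₁ y) = ∫ y, Φ₀ y * (Φ₁ x * Φ₀ y) :=
      integral_congr_ae (hx.mono fun y hy ↦ by simp only [hy])
    have h2 : ∫ y, Φ₀ y * (Φ₀ x * Φ₁ y) = Φ₀ x * c := by
      rw [hcdef, ← integral_const_mul]
      exact integral_congr_ae (Eventually.of_forall fun y ↦ by ring)
    have h3 : ∫ y, Φ₀ y * (Φ₁ x * Φ₀ y) = Φ₁ x * 1 := by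
      rw [← hn₀, ← integral_const_mul]
      exact integral_congr_ae (Eventually.of_forall fun y ↦ by ring)
    rw [h2, h3, mul_one] at h1
    linarith
  -- `c = 1`
  have hc0 : 0 ≤ c := integral_nonneg fun y ↦ mul_nonneg (h₀ y) (h₁ y)
  have hc1 : c ^ 2 = 1 := by
    have h1 : ∫ x, Φ₁ x ^ 2 = ∫ x, c ^ 2 * Φ₀ x ^ 2 :=
      integral_congr_ae (hprop.mono fun x hx ↦ by simp only [hx]; ring)
    rw [integral_const_mul, hn₀, hn₁] at h1
    linarith
  have hc : c = 1 := by nlinarith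
  filter_upwards [hprop] with x hx
  rw [hx, hc, one_mul]

/-- **The non-negative minimiser is even.** Under the hypotheses of `nonneg_minimizer_ae_eq` on a
single non-negative normalised minimiser `Φ`, `Φ(x) = Φ(−x)` for a.e. `x`: the reflected function
`Φ(−·)` is again a non-negative normalised minimiser (`𝓔_a` and the window are reflection
invariant, `weilDirichletEnergy_comp_neg`), so uniqueness applies. -/
theorem nonneg_minimizer_even {a E : ℝ} {Φ : ℝ → ℝ}
    (hm : Measurable Φ) (h0 : ∀ x, 0 ≤ Φ x) (hL : MemLp Φ 2)
    (hs : ∀ x, x ∉ Icc (-a) a → Φ x = 0) (hn : ∫ x, Φ x ^ 2 = 1)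
    (hfin : IntegrableOn (fun t ↦ weilArchDensity t * weilIncrement (fun x ↦ (Φ x : ℂ)) t)
      (Ioi 0))
    (hE : weilDirichletEnergy a (fun x ↦ (Φ x : ℂ)) ≤ E)
    (hbot : ∀ v : ℝ → ℂ, MemLp v 2 → (∀ x, x ∉ Icc (-a) a → v x = 0) →
      IntegrableOn (fun t ↦ weilArchDensity t * weilIncrement v t) (Ioi 0) →
      E * ∫ x, ‖v x‖ ^ 2 ≤ weilDirichletEnergy a v) :
    Φ =ᵐ[volume] fun x ↦ Φ (-x) := by
  have hm' : Measurable fun x ↦ Φ (-x) := hm.comp measurable_neg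
  have hL' : MemLp (fun x ↦ Φ (-x)) 2 :=
    hL.comp_measurePreserving (Measure.measurePreserving_neg volume)
  have hs' : ∀ x, x ∉ Icc (-a) a → Φ (-x) = 0 := fun x hx ↦ hs (-x) fun h ↦ hx (by
    rcases h with ⟨h1, h2⟩
    exact ⟨by linarith, by linarith⟩)
  have hn' : ∫ x, Φ (-x) ^ 2 = 1 := by
    rw [← hn]
    exact integral_neg_eq_self (fun x ↦ Φ x ^ 2) volume
  have hD : ∀ t, weilIncrement (fun x ↦ (Φ (-x) : ℂ)) t = weilIncrement (fun x ↦ (Φ x : ℂ)) t :=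
    fun t ↦ weilIncrement_comp_neg (fun x ↦ (Φ x : ℂ)) t
  have hfin' : IntegrableOn
      (fun t ↦ weilArchDensity t * weilIncrement (fun x ↦ (Φ (-x) : ℂ)) t) (Ioi 0) := by
    simp only [hD]
    exact hfin
  have hE' : weilDirichletEnergy a (fun x ↦ (Φ (-x) : ℂ)) ≤ E := by
    have h := weilDirichletEnergy_comp_neg a (fun y ↦ (Φ y : ℂ))
    exact (le_of_eq h).trans hE
  exact nonneg_minimizer_ae_eq hm hm' h0 (fun x ↦ h0 (-x)) hL hL' hs hs' hn hn' hfin hfin'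
    hE hE' hbot

end Summit.RiemannHypothesis.RiemannHypothesis.Theorems.WeilGroundStateMarkovPart

end
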